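import Literature.Probability.Percolation.OpenPathAnnulusCrossing
import Literature.Topology.PlaneTopology.BandCrossing
import HarnessLib

/-!
# Sub-continua between two level sets; open annulus crossings from unconfined continua

Topic `Literature/Probability/Percolation` (bond percolation on `δℤ²` drawn in the plane).  A small
proofs file feeding the tree's RSW annulus bound `annulusOpenCrossing_half_le_holds`
(`AnnulusCrossingBound*.lean`) from the continuum crossings of Schramm–Smirnov's setting
(*On the scaling limits of planar percolation*, Ann. Probab. 39 (2011), arXiv:1101.5820; §2, proof
of Thm. 1.1: "the four arm event from `∂B_j` to `∂Q₀`"; "the probability … that there is a crossing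
of `Q₀` which intersects any of the disks `B(xᵢ, r)`"; §6), where the arms one extracts are
connected compact pieces of a crossing, known to meet a small ball and to reach far away, but not
confined to the annulus in question:

* `exists_subcontinuum_between_levels` — for a continuous `φ` on a Hausdorff space, a compact
  connected `K` meeting `{φ ≤ a}` and `{φ ≥ b}` (`a ≤ b`) contains a compact connected
  `K' ⊆ {a ≤ φ ≤ b}` meeting both level sets `{φ = a}`, `{φ = b}` (cut-wire theorem
  `exists_closed_separation`; the case `φ = re` is `exists_subcontinuum_between_lines` of
  `StripCrossings.lean`, whose proof is followed verbatim);
* `exists_subcontinuum_annulus` — the case `φ = dist · x`: a continuum meeting `B̄(x, r)` and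
  `{dist · x ≥ R}` contains a continuum inside the closed annulus `r ≤ dist · x ≤ R` meeting both
  circles;
* `mem_annulusOpenCrossing_of_isPreconnected'` — hence a continuum inside the drawn open edges
  `openEdgeUnion δ ω` meeting `B̄(x, r)` and `{dist · x ≥ R}` puts `ω` in
  `annulusOpenCrossing x δ (r + δ) (R - δ)` (the tree's `mem_annulusOpenCrossing_of_isPreconnected`
  asks the continuum to lie inside `B̄(x, R)`).

No definitions, no named fact.

## References

* O. Schramm, S. Smirnov, Ann. Probab. 39 (2011) 1768–1814, arXiv:1101.5820, §2 (proof of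
  Thm. 1.1). [SchrammSmirnov2011]
* K. Kuratowski, *Topology* II (1968), §47.II Thm. 3 (cut-wire theorem).
-/

noncomputable section

open Set Metric
open Literature.Topology.PlaneTopology Literature.Probability.LatticeModels

namespace Literature.Probability.Percolation

/-! ### A continuum crossing between two level sets contains a sub-continuum between them -/

/-- **Sub-continuum between two levels.**  Let `φ : X → ℝ` be continuous on a Hausdorff space, `K`
compact and (pre)connected, meeting `{φ ≤ a}` and `{b ≤ φ}` with `a ≤ b`.  Then some compact
preconnected `K' ⊆ K` lies in `{a ≤ φ ≤ b}` and meets both `{φ = a}` and `{φ = b}`.  (If no connected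
subset of `Z = K ∩ {a ≤ φ ≤ b}` met both level sets, the cut-wire theorem would split
`Z = Z₁ ⊔ Z₂` with `Z₁` off `{φ = b}` and `Z₂` off `{φ = a}`, and then `(K ∩ {φ ≤ a}) ∪ Z₁`,
`(K ∩ {b ≤ φ}) ∪ Z₂` would disconnect `K`.) [folklore] -/
theorem exists_subcontinuum_between_levels {X : Type*} [TopologicalSpace X] [T2Space X]
    {φ : X → ℝ} (hφ : Continuous φ) {K : Set X} {a b : ℝ} (hab : a ≤ b)
    (hK : IsCompact K) (hKc : IsPreconnected K) (hKa : ∃ z ∈ K, φ z ≤ a)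
    (hKb : ∃ z ∈ K, b ≤ φ z) :
    ∃ K' ⊆ K, IsCompact K' ∧ IsPreconnected K' ∧ (∀ z ∈ K', a ≤ φ z ∧ φ z ≤ b) ∧
      (∃ z ∈ K', φ z = a) ∧ ∃ z ∈ K', φ z = b := by
  obtain ⟨za, hza, hzare⟩ := hKa
  obtain ⟨zb, hzb, hzbre⟩ := hKb
  rcases hab.eq_or_lt with rfl | hab'
  · -- `a = b`: a single point of `K` on the level `φ = a`
    obtain ⟨z, hz, hzre⟩ : a ∈ φ '' K :=
      hKc.intermediate_value hza hzb hφ.continuousOn ⟨hzare, hzbre⟩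
    refine ⟨{z}, singleton_subset_iff.2 hz, isCompact_singleton, isPreconnected_singleton,
      fun w hw => ?_, ⟨z, rfl, hzre⟩, ⟨z, rfl, hzre⟩⟩
    rw [mem_singleton_iff.1 hw, hzre]
    exact ⟨le_rfl, le_rfl⟩
  set Z : Set X := K ∩ {z | a ≤ φ z ∧ φ z ≤ b} with hZ
  have hZc : IsCompact Z := hK.inter_right
    ((isClosed_le continuous_const hφ).inter (isClosed_le hφ continuous_const))
  by_cases h : ∃ C ⊆ Z, IsPreconnected C ∧ (∃ z ∈ C, φ z = a) ∧ ∃ z ∈ C, φ z = b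
  · obtain ⟨C, hCZ, hCc, ⟨u, hu, hure⟩, ⟨v, hv, hvre⟩⟩ := h
    have hcl : closure C ⊆ Z := closure_minimal hCZ hZc.isClosed
    exact ⟨closure C, hcl.trans inter_subset_left, hZc.of_isClosed_subset isClosed_closure hcl,
      hCc.closure, fun z hz => (hcl hz).2, ⟨u, subset_closure hu, hure⟩,
      ⟨v, subset_closure hv, hvre⟩⟩
  · exfalso
    obtain ⟨Z₁, Z₂, hZ₁, hZ₂, hdisj, hunion, hZ₁b, hZ₂a⟩ :=
      exists_closed_separation (A := {z : X | φ z = a}) (B := {z : X | φ z = b}) hZc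
        (isClosed_eq hφ continuous_const) (isClosed_eq hφ continuous_const)
        (fun C hC hCc hCa hCb => h ⟨C, hC, hCc, hCa, hCb⟩)
    have hZ₁sub : Z₁ ⊆ Z := hunion ▸ subset_union_left
    have hZ₂sub : Z₂ ⊆ Z := hunion ▸ subset_union_right
    set U₁ : Set X := (K ∩ {z | φ z ≤ a}) ∪ Z₁ with hU₁
    set U₂ : Set X := (K ∩ {z | b ≤ φ z}) ∪ Z₂ with hU₂
    have hU₁c : IsClosed U₁ :=
      (hK.isClosed.inter (isClosed_le hφ continuous_const)).union hZ₁
    have hU₂c : IsClosed U₂ :=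
      (hK.isClosed.inter (isClosed_le continuous_const hφ)).union hZ₂
    have hcover : K ⊆ U₁ ∪ U₂ := fun z hz => by
      by_cases h1 : φ z ≤ a
      · exact Or.inl (Or.inl ⟨hz, h1⟩)
      by_cases h2 : b ≤ φ z
      · exact Or.inr (Or.inl ⟨hz, h2⟩)
      have hzZ : z ∈ Z := ⟨hz, (not_le.1 h1).le, (not_le.1 h2).le⟩
      rw [← hunion] at hzZ
      rcases hzZ with hz1 | hz2
      · exact Or.inl (Or.inr hz1)
      · exact Or.inr (Or.inr hz2)
    obtain ⟨z, -, hz₁, hz₂⟩ := isPreconnected_closed_iff.1 hKc U₁ U₂ hU₁c hU₂c hcover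
      ⟨za, hza, Or.inl ⟨hza, hzare⟩⟩ ⟨zb, hzb, Or.inl ⟨hzb, hzbre⟩⟩
    rcases hz₁ with ⟨-, hz₁⟩ | hz₁ <;> rcases hz₂ with ⟨-, hz₂⟩ | hz₂
    · exact absurd (hz₂.trans hz₁) (not_le.2 hab')
    · exact Set.disjoint_left.1 hZ₂a hz₂ (show φ z = a from le_antisymm hz₁ (hZ₂sub hz₂).2.1)
    · exact Set.disjoint_left.1 hZ₁b hz₁ (show φ z = b from le_antisymm (hZ₁sub hz₁).2.2 hz₂)
    · exact Set.disjoint_left.1 hdisj hz₁ hz₂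

/-- **Sub-continuum inside a closed annulus.**  A compact preconnected `K ⊆ ℂ` meeting the closed
ball `B̄(x, r)` and the exterior `{R ≤ dist · x}` (`r ≤ R`) contains a compact preconnected `K'`
inside the closed annulus `{r ≤ dist · x ≤ R}` meeting both circles. [folklore] -/
theorem exists_subcontinuum_annulus {K : Set ℂ} (x : ℂ) {r R : ℝ} (hrR : r ≤ R) (hK : IsCompact K)
    (hKc : IsPreconnected K) (hKr : ∃ z ∈ K, dist z x ≤ r) (hKR : ∃ z ∈ K, R ≤ dist z x) :
    ∃ K' ⊆ K, IsCompact K' ∧ IsPreconnected K' ∧ (∀ z ∈ K', r ≤ dist z x ∧ dist z x ≤ R) ∧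
      (∃ z ∈ K', dist z x = r) ∧ ∃ z ∈ K', dist z x = R :=
  exists_subcontinuum_between_levels (continuous_id.dist continuous_const) hrR hK hKc hKr hKR

/-! ### Open annulus crossings from unconfined continua inside the open edges -/

variable {δ : ℝ} {ω : BondConfig (Site 2)}

/-- **An unconfined continuum inside the open edges crossing an annulus gives an open lattice
crossing.**  If a compact preconnected `K ⊆ openEdgeUnion δ ω` (`δ > 0`) has a point within `r` of
`x` and a point at distance `≥ R` from `x` (`r ≤ R`), then `ω ∈ annulusOpenCrossing x δ (r + δ) (R - δ)`
(restrict to a sub-continuum inside the closed annulus, `exists_subcontinuum_annulus`, and apply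
the tree's `mem_annulusOpenCrossing_of_isPreconnected`). [cite: SchrammSmirnov2011, §2 (proof of Thm. 1.1: arms from ∂B_j, crossings meeting B(xᵢ, r))] -/
theorem mem_annulusOpenCrossing_of_isPreconnected' (hδ : 0 < δ) (x : ℂ) {r R : ℝ} (hrR : r ≤ R)
    {K : Set ℂ} (hKc : IsCompact K) (hK : IsPreconnected K) (hKO : K ⊆ openEdgeUnion δ ω)
    (hKr : ∃ z ∈ K, dist z x ≤ r) (hKR : ∃ z ∈ K, R ≤ dist z x) :
    ω ∈ annulusOpenCrossing x δ (r + δ) (R - δ) := by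
  obtain ⟨K', hK'K, hK'c, hK'conn, hK'ann, ⟨a, ha, har⟩, ⟨b, hb, hbR⟩⟩ :=
    exists_subcontinuum_annulus x hrR hKc hK hKr hKR
  exact mem_annulusOpenCrossing_of_isPreconnected hδ x hK'c hK'conn (hK'K.trans hKO) ha hb har.le
    hbR.ge fun z hz => (hK'ann z hz).2

end Literature.Probability.Percolation

end
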